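import Literature.AnabelianGeometry.EtaleTheta.SettingModelTateProp15iiiShearRigidity
import Literature.AnabelianGeometry.EtaleTheta.ThetaLiftUnique
import Literature.AnabelianGeometry.EtaleTheta.SettingModelTateProp15TruthTable
import HarnessLib

/-!
# The STAGE-2 (Tate-sheared) χ-model of [EtTh] §1 (row R270′, generic `(i, j)`, part 2): the typed Prop. 1.5 (iii) ALSO PINS
# THE INNER EXPONENT — `Prop15iii(η̈♯) ⇒ i = 1`; hence `Prop15iii(η̈♯) ↔ (i, j) = (1, 2)` at `modelχq p i j`

S. Mochizuki, *The étale theta function and its Frobenioid-theoretic manifestations*, Publ. RIMS **45** (2009)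
[EtTh], §1, Prop. 1.5 (iii), PRIMS PDF p. 23 (printed 249): "… arises from a unique class `η̈^Θ ∈ H¹((Π^tp_Ÿ)^Θ, Δ_Θ)` …
on which `a ∈ Z` acts as follows: `η̈^Θ ↦ η̈^Θ − 2a·log(Ü) − (a²/2)·log(q_X) + log(O^×_K̈)`"
[cite: MochizukiEtTh2009, Prop 1.5 (iii) p.23]. Layer L2 of the abc-iut cell, R78 cluster STAGE 2, row R270′ part (i)
(abc-iut-L2-lead R362), seat abc-iut-L2-t12 (gen 6). PROOF-ONLY (0 definitions). Part (j) is this seat's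
`SettingModelTateProp15iiiShearRigidity` (`j = 2` forced by the `log(Ü)`-display). Here the `x′`-display: the generic-`i`
twins of abc-iut-L2-t6's `i = 1` lemmas `toTheta_inl_zRepr_deckConj` / `conj_deckGen_zClassYddχq`
(`SettingModelTateDeckLevels` / `SettingModelTateDeckDisplay`, whose proofs are followed line by line with `κ_p ↦ κ_p^i`),
this seat's gen-5 lift uniqueness `ThetaSetting.inflTheta_injective` (`ThetaLiftUnique`), and `qddUnit_zpow_mem_unitsOKdd_iff`.

RESULTS (every `i`, every even `j`, every Galois section `s`, every `hC`):
* `toTheta_inl_zRepr_deckConj_gen` — the `z`-part of the deck conjugate in the theta quotient drops by `c^{ŷ(g)}·c^{i·κ_p(τ)}`;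
* **`conj_deckGen_zClassYddχq_gen`** — `σ₀·x′ = x′ · log(Ü)^{−2} · κ̈(q̈)^{−i}` for `x′ = zClassYddχq p i j` (generic `i`);
* **`prop15iii_etaDdχq_only_if_one`** — `Prop15iii` for the étale-theta datum of `η̈♯ = etaDdχq` (any section) forces
  `i = 1`: the unique lift is `x′ = zClassYddχq` (`inflTheta_injective`), and comparing its typed display
  `σ₀·x′ = x′·log(Ü)^{−2}·κ̈(q̈)^{−1}·κ̈(u)` with the model's gives `q̈^{1−i} = u ∈ O^×_K̈`;
* **`prop15iii_etaDdχq_iff`** — `Prop15iii(E_{i,j,s}(η̈♯)) ↔ i = 1 ∧ j = 2` (with part (j) and abc-iut-L2-t6's positive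
  instance at `(1, 2)`): the typed Prop. 1.5 (iii) singles out EXACTLY the Tate twist `(κ_p, κ_p², χ)` among the
  stage-2 family `actχq = Inn(b^{κ_p^i}) ∘ shear_{κ_p^j} ∘ θ_χ`.
HONEST FRAMING: SEMI-SYNTHETIC model — consistency/sharpness evidence for the typed interface ONLY; nothing of [EtTh] is
asserted or denied; typed ≠ proved; no side is taken on [IUTchIII] Cor. 3.12.
-/

noncomputable section

namespace Literature.AnabelianGeometry.EtaleTheta.SettingModel

open Literature.AnabelianGeometry.SemiGraphs

variable (p : ℕ) [Fact p.Prime] (i j : ℤ) (hj : Even j)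

/-! ### The `z`-part of the deck conjugate at generic `i` -/

/-- **The `z`-part of the deck conjugate, in the theta quotient, generic `i`**: for `g = (γ, τ) ∈ Π^tp_Y`,
`θ(inl(γ′·b^{−ŷ(γ′)})) = θ(inl(γ·b^{−ŷ(γ)})) · c^{−ŷ(g)} · c^{−κ_p(τ)^i}` where `γ′ = a⁻¹ γ · actχq τ (a)` — levels
`(0, 0, z − y − κ_N^i)` on both sides (abc-iut-L2-t6's `i = 1` proof, verbatim with `κ_p ↦ κ_p^i`).
[cite: MochizukiEtTh2009, Prop 1.5 (iii) p.23] -/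
theorem toTheta_inl_zRepr_deckConj_gen {g : PiTpχq p i j} (hg : gfpSnd g.left = 1) :
    CurveTheta.toTheta (curveχq p i j) (SemidirectProduct.inl
        (((gfpOf (FreeGroup.of 0))⁻¹ * g.left * actχq p i j g.right (gfpOf (FreeGroup.of 0))) *
          (bPowGfp (eHatB (gfpFst ((gfpOf (FreeGroup.of 0))⁻¹ * g.left *
            actχq p i j g.right (gfpOf (FreeGroup.of 0))))))⁻¹)) =
      CurveTheta.toTheta (curveχq p i j) (SemidirectProduct.inl (g.left * (bPowGfp (eHatB (gfpFst g.left)))⁻¹)) *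
        (cThetaχq p i j (yCoordχq p i j g))⁻¹ * (cThetaχq p i j (kappaP p g.right ^ i))⁻¹ := by
  have hγ' : gfpSnd ((gfpOf (FreeGroup.of 0))⁻¹ * g.left * actχq p i j g.right (gfpOf (FreeGroup.of 0))) = 1 := by
    rw [map_mul, map_mul, map_inv, gfpSnd_actχq, hg, mul_one, inv_mul_cancel]
  set γ' : Gfp := (gfpOf (FreeGroup.of 0))⁻¹ * g.left * actχq p i j g.right (gfpOf (FreeGroup.of 0)) with hγ'def
  set A : Gfp := γ' * (bPowGfp (eHatB (gfpFst γ')))⁻¹ with hA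
  set B : Gfp := g.left * (bPowGfp (eHatB (gfpFst g.left)))⁻¹ with hB
  have key : CurveTheta.toTheta (curveχq p i j) (SemidirectProduct.inl A) =
      CurveTheta.toTheta (curveχq p i j)
        (SemidirectProduct.inl (B * (cGfpχ (yCoordχq p i j g))⁻¹ * (cGfpχ (kappaP p g.right ^ i))⁻¹)) := by
    refine toThetaq_eq_of_right_eq_one p i j _ _ (SemidirectProduct.right_inl _) (SemidirectProduct.right_inl _) ?_
    rw [SemidirectProduct.left_inl, SemidirectProduct.left_inl, mem_closure_commutator₃_iff_forall_hHat]
    intro N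
    have hy : (hHat N (gfpFst g.left)).y = Multiplicative.toAdd (ZHatLevel.level N (eHatB (gfpFst g.left))) := by
      rw [← modN_eq_level, ← hHat_y_eq_modN_eHatB, toAdd_ofAdd]
    have h1 : hHat N (gfpFst A) =
        ⟨0, 0, (hHat N (gfpFst g.left)).z - (hHat N (gfpFst g.left)).y -
          Multiplicative.toAdd (ZHatLevel.level N (kappaP p g.right ^ i))⟩ := by
      rw [hA, hHat_gfpFst_mul_bPowGfp_inv N hγ', hγ'def, hHat_gfpFst_deckConjLeft p i j N g.right hg]
    have h2 : hHat N (gfpFst B) = ⟨0, 0, (hHat N (gfpFst g.left)).z⟩ := by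
      rw [hB, hHat_gfpFst_mul_bPowGfp_inv N hg]
    simp only [map_mul, map_inv, h1, h2, hHat_gfpFst_cGfpχ, yCoordχq_apply]
    ext
    · simp
    · simp
    · simp [hy]
      ring
  rw [cThetaχq_apply, cThetaχq_apply, key]
  simp only [map_mul, map_inv]

/-! ### `hx₀` at generic `i`: `σ₀·x′ = x′ · log(Ü)^{−2} · κ̈(q̈)^{−i}` -/

/-- **The deck display of the `z`-class at generic `i`** (every `i`, even `j`): conjugation by `σ₀ = (a, 1)` sends
`x′ = zClassYddχq p i j` to `x′ · log(Ü)^{−2} · κ̈(q̈)^{−i}` (abc-iut-L2-t6's `conj_deckGen_zClassYddχq` is the case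
`i = 1`, with the unit `κ̈(1)` appended). [cite: MochizukiEtTh2009, Prop 1.5 (iii) p.23] -/
theorem conj_deckGen_zClassYddχq_gen (hC : (ThetaSetting.modelχq p i j hj).Compat) :
    haveI := hC.GtpYddTheta_normal
    ContH1.conj (MonoidHom.id (ThetaSetting.modelχq p i j hj).GtpTheta) (ThetaSetting.modelχq p i j hj).DeltaTheta
        ((ThetaSetting.modelχq p i j hj).toTheta (SemidirectProduct.inl (gfpOf (FreeGroup.of 0))))
        (zClassYddχq p i j hj) =
      zClassYddχq p i j hj * (kummerCoreχq p i j hj).logUdd ^ (-(2 : ℤ)) *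
        (kummerCoreχq p i j hj).toKummerData.kumYdd
          ((kummerCoreχq p i j hj).toKummerData.toKddHat (ThetaSetting.modelχq p i j hj).qddUnit) ^ (-i) := by
  haveI := hC.GtpYddTheta_normal
  letI := (ThetaSetting.modelχq p i j hj).unitsAction (kummerCoreχq p i j hj).augTheta
  rw [kumYdd_toKddHat_qddUnit_eq_mk]
  set K := (kummerCoreχq p i j hj).coeff.kummerContCocycle
    ((ThetaSetting.modelχq p i j hj).GtpYdd.map (ThetaSetting.modelχq p i j hj).toTheta)
    ((pRoots p).cast (pUnit_eq_toInvYdd_qddUnit p i j hj))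
    ((kummerCoreχq p i j hj).toInvYdd (ThetaSetting.modelχq p i j hj).qddUnit).2
    (fun _ => (kummerCoreχq p i j hj).isOpen_stabilizer' _) with hK
  set F : contCocycles (MonoidHom.id (ThetaSetting.modelχq p i j hj).GtpTheta) (ThetaSetting.modelχq p i j hj).DeltaTheta
      ((ThetaSetting.modelχq p i j hj).GtpYdd.map (ThetaSetting.modelχq p i j hj).toTheta) :=
    ⟨(yCoordKitχq p i j hj).logUddFun, (yCoordKitχq p i j hj).logUddFun_mem⟩ with hF
  set Z : contCocycles (MonoidHom.id (ThetaSetting.modelχq p i j hj).GtpTheta) (ThetaSetting.modelχq p i j hj).DeltaTheta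
      ((ThetaSetting.modelχq p i j hj).GtpYdd.map (ThetaSetting.modelχq p i j hj).toTheta) :=
    ⟨zFunχq p i j hj _ (Subgroup.map_mono (ThetaSetting.modelχq p i j hj).GtpYdd_le_GtpY),
      zFunχq_mem p i j hj _ (Subgroup.map_mono (ThetaSetting.modelχq p i j hj).GtpYdd_le_GtpY)⟩ with hZ
  let π : ↥(contCocycles (MonoidHom.id (ThetaSetting.modelχq p i j hj).GtpTheta) (ThetaSetting.modelχq p i j hj).DeltaTheta
      ((ThetaSetting.modelχq p i j hj).GtpYdd.map (ThetaSetting.modelχq p i j hj).toTheta)) →*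
      (ThetaSetting.modelχq p i j hj).H1Theta
        ((ThetaSetting.modelχq p i j hj).GtpYdd.map (ThetaSetting.modelχq p i j hj).toTheta) :=
    QuotientGroup.mk' _
  show ContH1.conj (MonoidHom.id (ThetaSetting.modelχq p i j hj).GtpTheta) (ThetaSetting.modelχq p i j hj).DeltaTheta
      ((ThetaSetting.modelχq p i j hj).toTheta (SemidirectProduct.inl (gfpOf (FreeGroup.of 0)))) (π Z) =
    π Z * (π F) ^ (-(2 : ℤ)) * (π K) ^ (-i)
  have e1 : ContH1.conj (MonoidHom.id (ThetaSetting.modelχq p i j hj).GtpTheta) (ThetaSetting.modelχq p i j hj).DeltaTheta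
      ((ThetaSetting.modelχq p i j hj).toTheta (SemidirectProduct.inl (gfpOf (FreeGroup.of 0)))) (π Z) =
      π (ContH1.conjCocycle (MonoidHom.id (ThetaSetting.modelχq p i j hj).GtpTheta) (ThetaSetting.modelχq p i j hj).DeltaTheta
        ((ThetaSetting.modelχq p i j hj).toTheta (SemidirectProduct.inl (gfpOf (FreeGroup.of 0)))) Z) := rfl
  rw [e1, ← map_zpow π, ← map_zpow π, ← map_mul π, ← map_mul π]
  congr 1
  refine Subtype.ext (funext fun h => ?_)
  obtain ⟨g, hg, hgh⟩ := h.2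
  have hg0 : gfpSnd g.left = 1 :=
    gfpSnd_left_eq_one_of_mem_gtpY_modelχq p i j hj ((ThetaSetting.modelχq p i j hj).GtpYdd_le_GtpY hg)
  rw [ContH1.conjCocycle_apply, MonoidHom.id_apply]
  refine (conjNormal_toThetaq_eq_self p i j hj (SemidirectProduct.right_inl _) _).trans ?_
  apply Subtype.ext
  simp only [Subgroup.coe_mul, Subgroup.coe_zpow, Pi.mul_apply, Pi.pow_apply]
  rw [coe_kummerContCocycle_qdd_apply, hZ, coe_zFunχq, coe_zFunχq]
  change zPartχq p i j ((MulAut.conjNormal ((ThetaSetting.modelχq p i j hj).toTheta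
      (SemidirectProduct.inl (gfpOf (FreeGroup.of 0))))⁻¹ h : _) : _) =
    zPartχq p i j h.1 * (cThetaχq p i j (half ⟨yThetaχq p i j h.1, _⟩)) ^ (-(2 : ℤ)) *
      (cThetaχq p i j (kappaP p (CurveTheta.augTheta (curveχq p i j) h.1))) ^ (-i)
  rw [zpow_neg, zpow_two, ← map_mul (cThetaχq p i j), ← pow_two, half_sq, ← map_zpow (cThetaχq p i j), zpow_neg,
    map_inv (cThetaχq p i j), MulAut.conjNormal_apply, inv_inv]
  change zPartχq p i j ((CurveTheta.toTheta (curveχq p i j) (SemidirectProduct.inl (gfpOf (FreeGroup.of 0))))⁻¹ *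
      h.1 * CurveTheta.toTheta (curveχq p i j) (SemidirectProduct.inl (gfpOf (FreeGroup.of 0)))) =
    zPartχq p i j h.1 * (cThetaχq p i j (yThetaχq p i j h.1))⁻¹ *
      (cThetaχq p i j (kappaP p (CurveTheta.augTheta (curveχq p i j) h.1) ^ i))⁻¹
  rw [← hgh]
  change zPartχq p i j ((CurveTheta.toTheta (curveχq p i j) (SemidirectProduct.inl (gfpOf (FreeGroup.of 0))))⁻¹ *
      CurveTheta.toTheta (curveχq p i j) g * CurveTheta.toTheta (curveχq p i j)
        (SemidirectProduct.inl (gfpOf (FreeGroup.of 0)))) =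
    zPartχq p i j (CurveTheta.toTheta (curveχq p i j) g) *
      (cThetaχq p i j (yThetaχq p i j (CurveTheta.toTheta (curveχq p i j) g)))⁻¹ *
      (cThetaχq p i j (kappaP p (CurveTheta.augTheta (curveχq p i j) (CurveTheta.toTheta (curveχq p i j) g)) ^ i))⁻¹
  rw [← map_inv, ← map_mul, ← map_mul, zPartχq_toTheta, zPartχq_toTheta, yThetaχq_toTheta,
    CurveTheta.augTheta_toTheta, deckConj_eq]
  exact toTheta_inl_zRepr_deckConj_gen p i j hg0

/-! ### `Prop15iii ⇒ i = 1`, and the exact pinning `(i, j) = (1, 2)` -/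

section OfSection

variable (s : GQp p →* (ThetaSetting.modelχq p i j hj).PiTemp) (hs : Continuous s)
  (hsec : ∀ σ : GQp p, (ThetaSetting.modelχq p i j hj).aug (s σ) = σ)
  (hsY : (ThetaSetting.modelχq p i j hj).GK.map s ≤ (ThetaSetting.modelχq p i j hj).GtpY)
  (hsYdd : (ThetaSetting.modelχq p i j hj).GKdd.map s ≤ (ThetaSetting.modelχq p i j hj).GtpYdd)

/-- **`Prop15iii(η̈♯) ⇒ i = 1`**: for the étale-theta datum of `η̈♯ = etaDdχq` over the section Kummer datum of
`kummerCoreχq p i j` along any `s`, the typed Prop. 1.5 (iii) forces the inner exponent `i = 1`. The unique lift of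
`η̈♯` is `zClassYddχq` (`inflTheta_injective`); its typed display at `σ₀` (exponents `−2`, `−1`, a unit `u`) against
the model's (`−2`, `−i`) gives `κ̈(q̈)^{1−i} = κ̈(u)`, so `q̈^{1−i} ∈ O^×_K̈`. [cite: MochizukiEtTh2009, Prop 1.5 (iii) p.23] -/
theorem prop15iii_etaDdχq_only_if_one (hC : (ThetaSetting.modelχq p i j hj).Compat)
    (h15 : ThetaSetting.Prop15iii
      (((kummerCoreχq p i j hj).toKummerDataOfSection s hs hsec hsY hsYdd).etaleThetaDataOfClass (etaDdχq p i j hj)) hC) :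
    i = 1 := by
  haveI := hC.GtpYddTheta_normal
  have hη : etaDdχq p i j hj ∈
      (((kummerCoreχq p i j hj).toKummerDataOfSection s hs hsec hsY hsYdd).etaleThetaDataOfClass
        (etaDdχq p i j hj)).thetaClasses :=
    ⟨1, one_mem _, by rw [one_mul]; rfl⟩
  obtain ⟨x', ⟨hx', -, hlaw⟩, -⟩ := h15 _ hη
  have hxz : x' = zClassYddχq p i j hj :=
    (ThetaSetting.modelχq p i j hj).inflTheta_injective _ (hx'.trans (etaDdχq_def p i j hj))
  subst hxz
  obtain ⟨u, hu, hdisp⟩ := hlaw (SemidirectProduct.inl (gfpOf (FreeGroup.of 0)))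
  rw [toZ_inl_gfpOf_a, toAdd_ofAdd, mul_one, mul_one] at hdisp
  -- the section datum's unit classes are the core's; `log(Ü)` of the datum is the core's
  change ContH1.conj _ _ _ (zClassYddχq p i j hj) = zClassYddχq p i j hj * (kummerCoreχq p i j hj).logUdd ^ (-(2 : ℤ)) *
      ((kummerCoreχq p i j hj).toKummerDataOfSection s hs hsec hsY hsYdd).kumYdd
        (((kummerCoreχq p i j hj).toKummerDataOfSection s hs hsec hsY hsYdd).toKddHat
          (ThetaSetting.modelχq p i j hj).qddUnit) ^ (-(1 : ℤ)) *
      ((kummerCoreχq p i j hj).toKummerDataOfSection s hs hsec hsY hsYdd).kumYdd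
        (((kummerCoreχq p i j hj).toKummerDataOfSection s hs hsec hsY hsYdd).toKddHat u) at hdisp
  rw [kumYdd_toKddHat_ofSection_modelχq, kumYdd_toKddHat_ofSection_modelχq,
    conj_deckGen_zClassYddχq_gen p i j hj hC, mul_assoc (zClassYddχq p i j hj * _ )] at hdisp
  have h' := mul_left_cancel hdisp
  -- `κ̈(q̈)^{−i} = κ̈(q̈)^{−1} · κ̈(u)`, so `q̈^{1−i} = u`
  rw [← map_zpow, ← map_zpow, ← map_zpow, ← map_zpow, ← map_mul, ← map_mul] at h'
  have heq : (ThetaSetting.modelχq p i j hj).qddUnit ^ (-i) = (ThetaSetting.modelχq p i j hj).qddUnit ^ (-(1 : ℤ)) * u :=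
    (kummerCoreχq p i j hj).toKummerData.toKddHat_injective ((kummerCoreχq p i j hj).toKummerData.kumYdd_injective h')
  have hmem : (ThetaSetting.modelχq p i j hj).qddUnit ^ (1 - i) ∈ (ThetaSetting.modelχq p i j hj).unitsOKdd := by
    have e : (ThetaSetting.modelχq p i j hj).qddUnit ^ (1 - i) = u := by
      rw [show (1 : ℤ) - i = (1 : ℤ) + (-i) by ring, zpow_add, heq, ← mul_assoc, ← zpow_add, add_neg_cancel,
        zpow_zero, one_mul]
    rw [e]
    exact hu
  have h0 := ((ThetaSetting.modelχq p i j hj).qddUnit_zpow_mem_unitsOKdd_iff _).mp hmem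
  omega

/-- **THE PINNING**: at `modelχq p i j` the typed Prop. 1.5 (iii) for the `z`-class datum `η̈♯ = etaDdχq` (over the section
Kummer datum of any Galois section) holds IFF `(i, j) = (1, 2)` — the Tate twist `(κ_p, κ_p², χ)` is the ONLY member of
the stage-2 family at which the typed `Z`-display holds (positive instance: abc-iut-L2-t6's
`prop15iii_etaleThetaDataOfClass_etaDdχq`). [cite: MochizukiEtTh2009, Prop 1.5 (iii) p.23] -/
theorem prop15iii_etaDdχq_iff (hC : (ThetaSetting.modelχq p i j hj).Compat) :
    ThetaSetting.Prop15iii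
        (((kummerCoreχq p i j hj).toKummerDataOfSection s hs hsec hsY hsYdd).etaleThetaDataOfClass (etaDdχq p i j hj))
        hC ↔ i = 1 ∧ j = 2 := by
  refine ⟨fun h15 => ⟨prop15iii_etaDdχq_only_if_one p i j hj s hs hsec hsY hsYdd hC h15,
    prop15iii_etaDdχq_only_if_two p i j hj hC s hs hsec hsY hsYdd h15⟩, ?_⟩
  rintro ⟨rfl, rfl⟩
  exact prop15iii_etaleThetaDataOfClass_etaDdχq p hC s hs hsec hsY hsYdd

end OfSection

/-- **Root-level census form of the pinning**: within the stage-2 family, the theta settings `modelχq p i j` whose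
`inr`-section datum of `η̈♯` satisfies the typed Prop. 1.5 (iii) are exactly those with `(i, j) = (1, 2)`.
[cite: MochizukiEtTh2009, Prop 1.5 (iii) p.23] -/
theorem prop15iii_etaDdχq_inr_iff (hC : (ThetaSetting.modelχq p i j hj).Compat) :
    ThetaSetting.Prop15iii
        (((kummerCoreχq p i j hj).toKummerDataOfSection SemidirectProduct.inr (continuous_inrχq p i j)
          (fun _ => rfl) (map_inr_GK_le_GtpY_modelχq' p i j hj) (map_inr_GKdd_le_GtpYdd_modelχq' p i j hj)).etaleThetaDataOfClass
          (etaDdχq p i j hj)) hC ↔ i = 1 ∧ j = 2 :=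
  prop15iii_etaDdχq_iff p i j hj _ _ _ _ _ hC

end Literature.AnabelianGeometry.EtaleTheta.SettingModel

end
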